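import Summits.QuantumFields.BalabanUV.Beta.EriceRemainderEnclosureHistoryAutonomyComparisonTwoAgesLemmas

/-!
# EriceRemainderEnclosureHistoryAutonomyComparisonTwoAgesFar — (E59d) TWO AFFINE AGES FAR APART COMPARE AT ANY SIZE: for `B(u) = b + L₁·u_{k₁} + L₂·u_{k₂}`
# with `1 ≤ k₁` and `k₂ ≥ 21·k₁`, THE STEP holds WITHOUT any condition on `L₁, L₂ ≥ 0` — by PEELING THE YOUNG AGE: its drop is paid by its own level
# weight `L₁·k₁·h_{k₁}³ ≤ √2` AND by the old age's drops over the next `k₁` scales, which cannot decrease by more than `O(k₁∕k₂)` (lattice derivative of the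
# coupling gap at old scales); the old age's drop is at most `(√2∕2)·η` (`effective_le_of_family_le_at_two_ages_far`)

Cell `pub-balaban`, β-function sub-cell, BINDER row D4 «RemainderConst leaves for Bałaban's split» (`HOME/BINDER-OWNERS.md`; owner lineage `b2b-balaban-beta-an4`;
this file by co-owner #2 lineage `b2b-balaban-beta-d4-p2`, generation 51), β-FLOW TEAM duty (1), FREEZE (0) honoured (def-free; (E59c)'s lemmas, (E41)'s `affine_monotone` ∕ `affine_floor` (the displayed lambda `b + Σ_{k<K} L_k·u_k`, here with weights supported on `{k₁, k₂}`),
(E49j)'s `excess_shift_le`, (E48a)'s `strictAnti_of_memFlow`, node U2's `invSq_eq_of_memFlow` ∕ `drive` ∕ `seqBox_shift` ∕ `Sharpness.abs_sub_le_half_cube_mul`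
BY NAME; nothing restated).  Third station of gen 51: the FAR half of «ANY TWO AFFINE AGES COMPARE AT ANY SIZE» over the lemmas of (E59c) `…ComparisonTwoAgesLemmas`; the NEAR half
(`k₂ ≤ 21·k₁`, where the profile condition of (E58b) holds) and the assembled theorem are the sequel (E59e) `…ComparisonTwoAges`.

HONEST FRAMING (page 1, verbatim and binding).  *"Discharging BetaPertH makes Bałaban's UV stability UNCONDITIONAL — a real constructive-QFT result; it is
NOT the continuum limit and NOT the Clay problem."*  THIS FILE DISCHARGES NOTHING OF THE KIND.  Elementary real analysis about an ABSTRACT affine functional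
with two memory ages on a box ]0,γ]^ℕ and abstract perturbations with displayed signs — hypotheses of a census, not facts; the form of Bałaban's (1.22)
limit functional is NOT PRINTED ([I] p. 298; GAPS G-t4-U2-1∕-2) and NOT asserted.  Row D4 class UNCHANGED (critical-path width 0; instance 0∕1; D4 DISCHARGE
NO DATE).  HONEST DEPENDENCY: continuum YM on T⁴ ⇐ BetaPertH ∧ nine spine estimates (0/9 proved); BetaPertH ⇐ (D1) ∧ (D4) ∧ CAP+tail; G-an2-4 gates asym,
D1 and NE2/3/4.

THE POINT (census sense (α); the COMPARISON column — the first result BEYOND level-weight bookkeeping).  (E58b) proves THE STEP from the level weight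
`Q = Σ_k L_k·k·h_k³ ≤ 2`, and `g51/e58/README.md` records that `Q` is UNBOUNDED over profiles (two hyper-separated ages already give `Q → ≈ 2.7`): for two
ages `k₁ ≪ k₂` each age can carry weight `≈ 1.35` at its own scale.  THIS FILE proves the step for two ages `k₂ ≥ 21·k₁` at ANY sizes by a different
bookkeeping.  Write the drop at the pin as `Y + X₀`, `Y = L₁·(h_{k₁} − h′_{k₁})`, `X_l = L₂·(h_{k₂+l} − h′_{k₂+l})`, and let `η` be the excess at the pin.
(1) `Y ≤ (√2∕(2k₁))·δ_{k₁}` (coupling gap ≤ `(h³∕2)`·level gap; **`accel_sqrt_two`**: `L·k·h_k³ ≤ √2` for EVERY term of an affine profile — `k·L·h_{2k} ≤ a_k`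
(`mul_term_read_le_invSq`) and `a_{2k} ≤ 2a_k` ((E58b) concavity)); (2) `δ_{k₁} ≤ k₁·η − Σ_{1≤l≤k₁} d_l` where the total drops `d_l ≥ X_l` — the old age's
drops over the young window REDUCE the young level gap (§2, increment identity `δ_{n+1} − δ_n = excess_n − d_{n+1}`); (3) `X₀ ≤ (√2∕2)·η` (accel for the old
age, `δ_{k₂} ≤ k₂·η`); (4) THE OLD DROP IS NEARLY CONSTANT OVER THE YOUNG WINDOW: `X_l ≥ (1 − 2l∕k₂)·X₀ − (√2∕(2k₂))·Σ_{i<l} d_{k₂+1+i}` (§1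
`gap_scaling`: the coupling gap produced by a FIXED level gap `δ` at the deeper scale `k₂ + l` is at least `(a_{k₂}∕a_{k₂+l})²` times the gap at `k₂` — an
exact algebraic identity `x − p = δ·x²p²∕(x+p)` — and `a_{k₂+l} ≤ (1 + l∕k₂)·a_{k₂}` by concavity; the level gap itself drops by at most the intermediate
drops), with `d_n ≤ (η∕2)·(3 + k₁∕k₂)` beyond `k₂` (`term_weight_far`: `L·h_{n+k}³ ≤ 1∕n`); (5) assembling, `Y + X₀ ≤ η·[√2 − 1∕2 + t + t(3+t)∕4] ≤ η`, `t = k₁∕k₂`, as soon as `k₂ ≥ 21·k₁` (`(k₁+1)∕k₂ ≤ 2∕21`, `√2 < 1.4143`).  So: for two ages far apart NO size condition and NO profile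
condition is needed; (E59d) adds the near range `k₂ ≤ 21·k₁` from (E58b) (`4r∕(1+r)² ≥ (√2 − 1)²` for `r ≤ 21`) and concludes: ANY two affine ages compare
at ANY size.  NOT CLAIMED: three or more ages (the peeling recursion and its constants are the successor's), a Markov term riding along (harmless for the
argument but not typed here), anything printed.

WHAT IS PROVED ([folklore]; 0 `def`, 0 sorry).  §1 `sum_pair`, **`mul_term_read_le_invSq`**, **`accel_sqrt_two`**, `term_weight_far`, **`gap_scaling`**, `sqrt_two_lt`.
§2 **`effective_le_of_family_le_at_two_ages_far`** (THE STEP for `k₂ ≥ 21·k₁`, any `L₁, L₂ ≥ 0`).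
-/
noncomputable section
open Finset Set

namespace Summit.QuantumFields.BalabanUV.Beta.EriceRemainderEnclosureHistoryAutonomyComparisonTwoAgesFar


open Literature.MathematicalPhysics.QuantumFieldTheory.Balaban1983to89
open Literature.MathematicalPhysics.QuantumFieldTheory.Balaban1983to89.T4BetaStationary
open Literature.MathematicalPhysics.QuantumFieldTheory.Balaban1983to89.T4BetaFlowWellPosed
open Literature.MathematicalPhysics.QuantumFieldTheory.Balaban1983to89.T4BetaFlowWellPosed.Sharpness (abs_sub_le_half_cube_mul)
open Summit.QuantumFields.BalabanUV.Beta.EriceRemainderEnclosureHistoryAutonomyOrder (strictAnti_of_memFlow)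
open Summit.QuantumFields.BalabanUV.Beta.EriceRemainderEnclosureHistoryAutonomyComparisonExcess (excess_shift_le)
open Summit.QuantumFields.BalabanUV.Beta.EriceRemainderEnclosureHistoryAutonomyComparisonAffineProfile (increment_anti mul_invSq_add_le)
open Summit.QuantumFields.BalabanUV.Beta.EriceRemainderEnclosureHistoryAutonomyMonotone (affine_monotone affine_floor)
open Summit.QuantumFields.BalabanUV.Beta.EriceRemainderEnclosureHistoryAutonomyComparisonTwoAgesLemmas

variable {B' : (ℕ → ℝ) → ℝ} {γ b y : ℝ} {L : ℕ → ℝ} {K k₁ k₂ : ℕ} {h h' : ℕ → ℝ}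

/-! ## THE STEP FOR TWO AGES FAR APART (`k₂ ≥ 21·k₁`), ANY SIZES -/

/-- **THE STEP FOR TWO AFFINE AGES FAR APART.**  `B(u) = b + Σ_{k<K} L_k·u_k` with `L ≥ 0` supported on `{k₁, k₂}`, `1 ≤ k₁`, `21·k₁ ≤ k₂ < K` — sizes
`L_{k₁}, L_{k₂}` ARBITRARY; `B ≤ B′` on the box with ISOTONE excess; `h`, `h′` box solutions of `B`, `B′` from one pin `y` with `h′ ≤ h` at every scale.  Then
`B h ≤ B′ h′`.  (Peeling the young age; see the module header for the bookkeeping.) [folklore] -/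
theorem effective_le_of_family_le_at_two_ages_far (hL : ∀ k, 0 ≤ L k) (hb : 0 < b) (hk₁ : 1 ≤ k₁) (hfar : 21 * k₁ ≤ k₂) (hk₂K : k₂ < K)
    (hsupp : ∀ k ∈ range K, k ≠ k₁ → k ≠ k₂ → L k = 0)
    (hexc : ∀ u, SeqBox γ u → (fun u : ℕ → ℝ => b + ∑ k ∈ range K, L k * u k) u ≤ B' u)
    (hDmono : ∀ u v : ℕ → ℝ, SeqBox γ u → SeqBox γ v → (∀ j, u j ≤ v j) →
      B' u - (fun u : ℕ → ℝ => b + ∑ k ∈ range K, L k * u k) u ≤ B' v - (fun u : ℕ → ℝ => b + ∑ k ∈ range K, L k * u k) v)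
    (hy : 0 < y) (hh : SeqBox γ h) (hf : MemFlow (fun u : ℕ → ℝ => b + ∑ k ∈ range K, L k * u k) y h) (hh' : SeqBox γ h')
    (hf' : MemFlow B' y h') (hle : ∀ j, h' j ≤ h j) :
    (fun u : ℕ → ℝ => b + ∑ k ∈ range K, L k * u k) h ≤ B' h' := by
  set B : (ℕ → ℝ) → ℝ := fun u : ℕ → ℝ => b + ∑ k ∈ range K, L k * u k with hB_def
  have hk₁K : k₁ ∈ range K := mem_range.mpr (by omega)
  have hk₂K' : k₂ ∈ range K := mem_range.mpr hk₂K
  have hne : k₁ ≠ k₂ := by omega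
  have hk₂1 : 1 ≤ k₂ := by omega
  have hk12 : k₁ ≤ k₂ := by omega
  have hlo : ∀ u, SeqBox γ u → b ≤ B u := affine_floor hL
  have hlo' : ∀ u, SeqBox γ u → b ≤ B' u := fun u hu => (hlo u hu).trans (hexc u hu)
  have hanti' : Antitone h' := (strictAnti_of_memFlow hb hlo' hh' hf').antitone
  have hk₁r : (0 : ℝ) < k₁ := by exact_mod_cast hk₁
  have hk₂r : (0 : ℝ) < k₂ := by exact_mod_cast hk₂1
  -- the excess at the pin and along h′
  set η : ℝ := B' h' - B h' with hη_def
  have hη0 : 0 ≤ η := by rw [hη_def]; linarith [hexc h' hh']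
  have hηs : ∀ n, |B (fun j => h' (n + 1 + j)) - B' (fun j => h' (n + 1 + j))| ≤ η := excess_shift_le hexc hDmono hh' hanti'
  -- gaps and level gaps
  have hg0 : ∀ n, 0 ≤ h n - h' n := fun n => by linarith [hle n]
  set δ : ℕ → ℝ := fun n => 1 / h' n ^ 2 - 1 / h n ^ 2 with hδ_def
  have hδ0 : ∀ n, 0 ≤ δ n := fun n =>
    sub_nonneg.mpr (one_div_le_one_div_of_le (pow_pos (hh' n).1 2) (pow_le_pow_left₀ (hh' n).1.le (hle n) 2))
  have hgδ : ∀ n, h n - h' n ≤ h n ^ 3 / 2 * δ n := by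
    intro n
    have hw := abs_sub_le_half_cube_mul (hh n).1 (hh' n).1 le_rfl (hle n)
    rw [abs_of_nonneg (hg0 n), abs_sub_comm, abs_of_nonneg (hδ0 n)] at hw
    exact hw
  -- the drop read at scale n
  set dd : ℕ → ℝ := fun n => L k₁ * (h (n + k₁) - h' (n + k₁)) + L k₂ * (h (n + k₂) - h' (n + k₂)) with hdd_def
  have hdrop_eq : ∀ n, B (fun j => h (n + j)) - B (fun j => h' (n + j)) = dd n := by
    intro n
    simp only [hB_def, hdd_def]
    rw [add_sub_add_left_eq_sub, ← sum_sub_distrib,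
      show ∑ x ∈ range K, (L x * h (n + x) - L x * h' (n + x)) = ∑ x ∈ range K, L x * (h (n + x) - h' (n + x)) from
        sum_congr rfl fun x _ => by ring,
      sum_pair hk₁K hk₂K' hne hsupp]
  have hdd0 : ∀ n, 0 ≤ dd n := fun n => by
    simp only [hdd_def]; exact add_nonneg (mul_nonneg (hL _) (hg0 _)) (mul_nonneg (hL _) (hg0 _))
  have hddX : ∀ n, L k₂ * (h (n + k₂) - h' (n + k₂)) ≤ dd n := fun n => by
    simp only [hdd_def]; linarith [mul_nonneg (hL k₁) (hg0 (n + k₁))]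
  -- the increment identity: δ(n+1) − δ(n) = excess_n − dd(n+1), 0 ≤ excess_n ≤ η
  have hinc : ∀ n, δ (n + 1) - δ n ≤ η - dd (n + 1) ∧ -dd (n + 1) ≤ δ (n + 1) - δ n := by
    intro n
    have e1 := hf.2 n
    have e2 := hf'.2 n
    have hd := hdrop_eq (n + 1)
    have ex1 := (abs_le.mp (hηs n)).1
    have ex0 : B (fun j => h' (n + 1 + j)) ≤ B' (fun j => h' (n + 1 + j)) := hexc _ (seqBox_shift hh' (n + 1))
    simp only [hδ_def]
    constructor <;> linarith
  have hδ_zero : δ 0 = 0 := by simp only [hδ_def]; rw [hf.1, hf'.1]; ring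
  have hδle : ∀ n : ℕ, δ n ≤ (n : ℝ) * η := by
    intro n
    induction n with
    | zero => rw [hδ_zero]; simp
    | succ n ih =>
      have := (hinc n).1
      have := hdd0 (n + 1)
      rw [Nat.cast_succ]; linarith
  have hδup : ∀ m : ℕ, δ m ≤ (m : ℝ) * η - ∑ l ∈ range m, dd (l + 1) := by
    intro m
    induction m with
    | zero => rw [hδ_zero]; simp
    | succ m ih =>
      have := (hinc m).1
      rw [Nat.cast_succ, sum_range_succ]; linarith
  have hδdown : ∀ n l : ℕ, δ n - ∑ i ∈ range l, dd (n + 1 + i) ≤ δ (n + l) := by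
    intro n l
    induction l with
    | zero => simp
    | succ l ih =>
      have := (hinc (n + l)).2
      rw [sum_range_succ, show n + (l + 1) = n + l + 1 by ring, show n + 1 + l = n + l + 1 by ring]
      linarith
  -- acceleration √2 for both ages
  set c : ℝ := Real.sqrt 2 / 2 with hc_def
  have hc0 : 0 ≤ c := by rw [hc_def]; positivity
  have hcc : c * c = 1 / 2 := by
    rw [hc_def]; have := Real.mul_self_sqrt (show (0:ℝ) ≤ 2 by norm_num); nlinarith [this]
  have hc1 : c ≤ 1 := by rw [hc_def]; linarith [sqrt_two_lt]
  have hterm : ∀ {k : ℕ}, (0 : ℝ) < k → L k * k * h k ^ 3 ≤ Real.sqrt 2 → L k * (h k ^ 3 / 2) ≤ c / k := by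
    intro k hk hacc
    rw [hc_def, le_div_iff₀ hk]; linarith
  have hL₁w := hterm hk₁r (accel_sqrt_two hL hb hy hh hf hk₁K hk₁)
  have hL₂w := hterm hk₂r (accel_sqrt_two hL hb hy hh hf hk₂K' hk₂1)
  -- (1) Y ≤ (c/k₁)·δ k₁ ≤ (c/k₁)(k₁η − Σ_{l<k₁} dd(l+1))
  set Y : ℝ := L k₁ * (h k₁ - h' k₁) with hY_def
  set X : ℝ := L k₂ * (h k₂ - h' k₂) with hX_def
  have hX0 : 0 ≤ X := mul_nonneg (hL _) (hg0 _)
  have hY : Y ≤ c / k₁ * ((k₁ : ℝ) * η - ∑ l ∈ range k₁, dd (l + 1)) := by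
    calc Y ≤ L k₁ * (h k₁ ^ 3 / 2 * δ k₁) := mul_le_mul_of_nonneg_left (hgδ k₁) (hL k₁)
      _ = L k₁ * (h k₁ ^ 3 / 2) * δ k₁ := by ring
      _ ≤ c / k₁ * δ k₁ := mul_le_mul_of_nonneg_right hL₁w (hδ0 k₁)
      _ ≤ c / k₁ * ((k₁ : ℝ) * η - ∑ l ∈ range k₁, dd (l + 1)) := mul_le_mul_of_nonneg_left (hδup k₁) (div_nonneg hc0 hk₁r.le)
  -- (3) X ≤ c η
  have hXc : X ≤ c * η := by
    calc X ≤ L k₂ * (h k₂ ^ 3 / 2 * δ k₂) := mul_le_mul_of_nonneg_left (hgδ k₂) (hL k₂)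
      _ = L k₂ * (h k₂ ^ 3 / 2) * δ k₂ := by ring
      _ ≤ c / k₂ * δ k₂ := mul_le_mul_of_nonneg_right hL₂w (hδ0 k₂)
      _ ≤ c / k₂ * ((k₂ : ℝ) * η) := mul_le_mul_of_nonneg_left (hδle k₂) (div_nonneg hc0 hk₂r.le)
      _ = c * η := by field_simp
  -- (4a) drops beyond k₂
  set D : ℝ := η / 2 * (3 + (k₁ : ℝ) / k₂) with hD_def
  have hD0 : 0 ≤ D := by positivity
  have hD : ∀ n, k₂ + 1 ≤ n → dd n ≤ D := fun n hn =>
    drop_far_le hL hb hy hh hf hh' hle hη0 hδle hk₁K hk₂K' hk12 hk₂1 hn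
  have hE : ∀ l : ℕ, ∑ i ∈ range l, dd (k₂ + 1 + i) ≤ (l : ℝ) * D := by
    intro l
    calc ∑ i ∈ range l, dd (k₂ + 1 + i) ≤ ∑ _i ∈ range l, D := sum_le_sum fun i _ => hD _ (by omega)
      _ = (l : ℝ) * D := by rw [sum_const, card_range, nsmul_eq_mul]
  -- (4b) the old drop over the young window: for 1 ≤ l ≤ k₁, X_l ≥ (1 − 2k₁/k₂)·X − (c/k₂)·k₁·D
  set W : ℝ := (1 - 2 * ((k₁ : ℝ) / k₂)) * X - c / k₂ * ((k₁ : ℝ) * D) with hW_def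
  have hXl : ∀ l ∈ range k₁, W ≤ dd (l + 1) := by
    intro l hl
    have hl' : l + 1 ≤ k₁ := mem_range.mp hl
    have hlr : ((l + 1 : ℕ) : ℝ) ≤ k₁ := by exact_mod_cast hl'
    have hwin := old_gap_window hL hb hy hh hf hh' hle hk₂1 (l + 1) (E := (((l + 1 : ℕ) : ℝ)) * D) (by positivity)
      (by have := hδdown k₂ (l + 1); have := hE (l + 1); simp only [hδ_def] at *; linarith)
    -- multiply by L k₂ and weaken the coefficients
    have h1 : L k₂ * ((1 - 2 * ((((l + 1 : ℕ) : ℝ)) / k₂)) * (h k₂ - h' k₂) - h k₂ ^ 3 / 2 * ((((l + 1 : ℕ) : ℝ)) * D))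
        ≤ L k₂ * (h (k₂ + (l + 1)) - h' (k₂ + (l + 1))) := mul_le_mul_of_nonneg_left hwin (hL k₂)
    have h2 : W ≤ L k₂ * ((1 - 2 * ((((l + 1 : ℕ) : ℝ)) / k₂)) * (h k₂ - h' k₂) - h k₂ ^ 3 / 2 * ((((l + 1 : ℕ) : ℝ)) * D)) := by
      have hratio : (((l + 1 : ℕ) : ℝ)) / k₂ ≤ (k₁ : ℝ) / k₂ := by rw [div_le_div_iff_of_pos_right hk₂r]; exact hlr
      have i1 : ((((l + 1 : ℕ) : ℝ)) / k₂) * X ≤ ((k₁ : ℝ) / k₂) * X := mul_le_mul_of_nonneg_right hratio hX0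
      have i2 : L k₂ * (h k₂ ^ 3 / 2) * ((((l + 1 : ℕ) : ℝ)) * D) ≤ c / k₂ * ((k₁ : ℝ) * D) :=
        mul_le_mul hL₂w (mul_le_mul_of_nonneg_right hlr hD0) (by positivity) (div_nonneg hc0 hk₂r.le)
      have e : L k₂ * ((1 - 2 * ((((l + 1 : ℕ) : ℝ)) / k₂)) * (h k₂ - h' k₂) - h k₂ ^ 3 / 2 * ((((l + 1 : ℕ) : ℝ)) * D))
          = X - 2 * (((((l + 1 : ℕ) : ℝ)) / k₂) * X) - L k₂ * (h k₂ ^ 3 / 2) * ((((l + 1 : ℕ) : ℝ)) * D) := by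
        simp only [hX_def]; ring
      have eW : W = X - 2 * (((k₁ : ℝ) / k₂) * X) - c / k₂ * ((k₁ : ℝ) * D) := by simp only [hW_def]; ring
      rw [e, eW]; linarith
    have h3 := hddX (l + 1)
    rw [show l + 1 + k₂ = k₂ + (l + 1) by ring] at h3
    linarith
  have hsum : (k₁ : ℝ) * W ≤ ∑ l ∈ range k₁, dd (l + 1) := by
    calc (k₁ : ℝ) * W = ∑ _l ∈ range k₁, W := by rw [sum_const, card_range, nsmul_eq_mul]
      _ ≤ ∑ l ∈ range k₁, dd (l + 1) := sum_le_sum hXl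
  -- (5) assembly: Y ≤ c(η − W), drop at the pin = Y + X
  have hY' : Y ≤ c * η - c * W := by
    have : c / k₁ * ((k₁ : ℝ) * η - ∑ l ∈ range k₁, dd (l + 1)) ≤ c / k₁ * ((k₁ : ℝ) * η - (k₁ : ℝ) * W) :=
      mul_le_mul_of_nonneg_left (by linarith) (div_nonneg hc0 hk₁r.le)
    have e : c / k₁ * ((k₁ : ℝ) * η - (k₁ : ℝ) * W) = c * η - c * W := by field_simp
    linarith
  have hdrop0 : B h - B h' = Y + X := by
    have := hdrop_eq 0
    simp only [hdd_def, zero_add] at this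
    simpa [hY_def, hX_def] using this
  -- the ratio t = k₁/k₂ ≤ 1/21 and the numerical assembly
  set t : ℝ := (k₁ : ℝ) / k₂ with ht_def
  have ht0 : 0 ≤ t := by positivity
  have ht1 : t ≤ 1 / 21 := by
    rw [ht_def, div_le_div_iff₀ hk₂r (by norm_num)]
    have : ((21 * k₁ : ℕ) : ℝ) ≤ k₂ := by exact_mod_cast hfar
    push_cast at this; linarith
  have hWeq : W = (1 - 2 * t) * X - c * t * D := by
    simp only [hW_def, ht_def]; field_simp
  have hDeq : D = η / 2 * (3 + t) := by simp only [hD_def, ht_def]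
  have hc2lt : 2 * c < 1.4143 := by rw [hc_def]; linarith [sqrt_two_lt]
  have hfin : Y + X ≤ η := peel_assembly hη0 hc0 hcc hc2lt ht0 ht1 hXc hDeq hWeq hY'
  rw [hη_def] at hfin
  linarith [hdrop0]
end Summit.QuantumFields.BalabanUV.Beta.EriceRemainderEnclosureHistoryAutonomyComparisonTwoAgesFar

end
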